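import Summits.ResolutionOfSingularities.ResolutionOfSingularities.Theorems.HilbertSamuelEliminationSigmaMaxModificationsCorridor3SigmaTameLowCoeff
import Summits.ResolutionOfSingularities.ResolutionOfSingularities.Theorems.HilbertSamuelEliminationSigmaMaxModificationsCorridor3SigmaTameLowBoard
import Summits.ResolutionOfSingularities.ResolutionOfSingularities.Theorems.HilbertSamuelEliminationSigmaMaxModificationsCorridor3SigmaTameNoMemberSurface
import Literature.AlgebraicGeometry.Resolution.RegularSystemOfParameters
import HarnessLib

/-!
# [OURS · L1 W4.2] σ-LAYER, TAME-LOW row T-L2, FILE 1b — `Corridor3SigmaTameLowCoeffFrame`: (s3) the END-FRAME of the coefficient datum at a lineage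
# point after the base-point and snc phases ↦ res-L1-s42-pv-2's `Sigma.TameLowCorner` (T-L5, p556956), the RING-SIDE DICTIONARY of the board's verdicts
# PROVED (curve `{f_i = 0}` legal ⟺ `Coeff(J) ⊆ (f_i)^c` ⟺ `c ≤ w_i`; corner resolved ⟺ `Coeff(J) ⊄ 𝔪_y^c` ⟺ `w₁ + w₂ < c`), and (s4) the TAME-LOW
# FUEL TRIPLE in `ℕ ×ₗ ℕ ×ₗ ℕ` (VALUES only — the drops are row T-L6)
# (crux chain w42 `SigmaMaxModifications` stmt-ResolutionOfSingularities-18506 / conjunct `SigmaMaxModificationsCorridor3` stmt-ResolutionOfSingularities-19249;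
# res-L1-w42-plan-1 RULING v3.14-48 (PD)(v)(vi)/(PF) row T-L2 + DESK WORD 2026-08-27T18:33:36Z sockets (s3)(s4); DESK NOTE BD-1 (b): the contact element
# stays ABSTRACT — no `PerfectField`/`Smooth` binder enters this reading layer; seat res-L1-type-o2 g9 = «res-type-067/068 SUCCESSOR»;
# `--supports stmt-ResolutionOfSingularities-19249 --as helper`, counted 0)

HONEST FRAMING. OURS bookkeeping over FILE 1a (`…Corridor3SigmaTameLowCoeff`: `TameLow.CoeffDatum`, the PROVED Lipman factorisation `𝔞 = 𝔪on·(g)·𝔞♮`,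
`basePointCount`), res-L1-s42-pv-2's T-L5 (`…Corridor3SigmaTameLowBoard`: `Sigma.TameLowCorner`, `board`, `legal_curve₁_iff`, `resolved_iff`, `fuel`),
res-D-pv-038's r.s.p. kernels (`…Corridor3SigmaTameNoMemberSurface`: `Sigma.rsop_prime`, `Sigma.rsop_not_dvd_of_ne`) and the tree's quasi-regularity of
regular systems of parameters (`Literature…Resolution.coeff_mem_maximalIdeal_of_eval_mem_pow`, Matsumura 17.10). NOTHING here is a statement of
H. Hironaka's manuscript [Hironaka2017] nor of Cossart–Jannsen–Saito; every `theorem` is PROVED (classical commutative algebra in a two-dimensional regular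
local ring); the two `structure`/`def` groups are OURS readings; no named fact, no axiom, no instance, no notation. AI-typed; AI review weaker than expert review.

## Contents (namespace `…Theorems.SigmaMaxModificationsCorridor3.Sigma.TameLow`, continued)

* §4 `CoeffDatum.maxIdeal` (the maximal ideal `𝔪_y`, written through the datum's regularity field so statements need no instance), `mem_maxIdeal_iff`
  (`↔ ¬ IsUnit`), `maxIdeal_eq`, `spanFinrank_maxIdeal` (`= 2`).
* §5 **(s3) `CoeffDatum.EndFrame D`** — the state at a lineage point `y` AFTER (TL4)(i)(ii): an r.s.p. `(f₁, f₂)` of `𝒪_{H₂,y}` (`span {f₁,f₂} = 𝔪_y`: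
  the ≤ 2 snc branches through `y`, a phantom complementary parameter when only one), weights `w₁ w₂`, the MONOMIALITY LAW `𝔪on · g = f₁^{w₁} f₂^{w₂} ·`
  unit, `𝔞♮ = ⊤`, and ray ids `r₁ ≠ r₂`, `d`; **`EndFrame.toCorner : Sigma.TameLowCorner`** (weights, threshold `c = m·S₀`, `hc := c_pos`) — the ROW
  MAP onto T-L5. PROVED DICTIONARY: `coeff_eq_span` (`𝔞 = (f₁^{w₁} f₂^{w₂})`), `prime_f₁/₂`, `not_f₁_dvd_f₂` / `not_f₂_dvd_f₁` (038's kernels at `d = 2`),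
  `pow_dvd_pow_iff_of_prime`, **`coeff_le_span_f₁_pow_iff : 𝔞 ≤ (f₁^c) ↔ c ≤ w₁`** (and `f₂`), **`monomial_mem_maxIdeal_pow_iff` /
  `coeff_le_maxIdeal_pow_iff : 𝔞 ≤ 𝔪^n ↔ n ≤ w₁ + w₂`** (`ord_y Coeff(J) = w₁ + w₂`, quasi-regularity), `coeff_le_maxIdeal_pow_c_iff`,
  `not_coeff_le_maxIdeal_pow_c_iff` (VALUE DROP `⟺ w₁ + w₂ < c`), and **`board_dictionary`**: the three ring statements ⟺ T-L5's
  `board.Legal c {r₁}` / `{r₂}` / `board.Resolved c {d,r₁,r₂}` — the board's verdicts ARE the ring's.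
* §6 **(s4) `CoeffDatum.fuel D δ w : ℕ ×ₗ ℕ ×ₗ ℕ := (basePointCount, δ, w)`** (`δ` = the snc-defect READING of row T-L4, `w` = T-L5's weight sum;
  well-founded codomain as 002's `GroupRankReadingAny` requires), `EndFrame.fuel` (`(0, 0, w₁ + w₂)`), and the three lex comparison lemmas
  `fuel_lt_of_basePointCount_lt` / `fuel_lt_of_snc_lt` / `fuel_lt_of_weight_lt` + `EndFrame.fuel_lt_iff` (an end-game step lowers the fuel iff it
  lowers `w₁ + w₂` — T-L5's `fuel_curve₁_lt` / `fuel_pointChild_lt` plug in).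
The DROPS along the three phases are row T-L6 (`…Corridor3SigmaTameLowLaws`), not claimed here.

VACUITY SELF-CHECK. `EndFrame` is inhabited over any `CoeffDatum` whose coefficient ideal is `(f₁^{a} f₂^{b})` for an r.s.p. (take `members = ∅`:
`𝔪on = 1`, `g ~ f₁^a f₂^b`, `𝔞♮ = ⊤`); the dictionary lemmas have content (e.g. `coeff_le_span_f₁_pow_iff` fails for a NON-reduced pair: with
`f₂ := f₁` the right-hand side undercounts), which is exactly why `span_pair_eq` (r.s.p. = snc) is a field.
-/

noncomputable section

set_option linter.dupNamespace false -- mandated namespace of this single-conjunct summit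

open IsLocalRing Literature.AlgebraicGeometry.Resolution

namespace Summit.ResolutionOfSingularities.ResolutionOfSingularities.Theorems.SigmaMaxModificationsCorridor3.Sigma.TameLow

universe u

namespace CoeffDatum

variable {K : Type u} [Field K] (D : CoeffDatum K)

/-! ## §4. The maximal ideal of the germ, instance-free -/

/-- [OURS · L1 W4.2] The maximal ideal `𝔪_y` of the surface germ (written through the structure's regularity field, so that statements need no
instance). [folklore] -/
def maxIdeal : Ideal D.R := @IsLocalRing.maximalIdeal D.R _ D.isRegularLocalRing.toIsLocalRing

/-- `x ∈ 𝔪 ↔ x` is a non-unit. [folklore] -/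
theorem mem_maxIdeal_iff {x : D.R} : x ∈ D.maxIdeal ↔ ¬ IsUnit x := by
  haveI := D.isRegularLocalRing
  exact IsLocalRing.mem_maximalIdeal x

/-- `maxIdeal` IS `maximalIdeal` (once the instance is in scope). [folklore] -/
theorem maxIdeal_eq : haveI := D.isRegularLocalRing; D.maxIdeal = IsLocalRing.maximalIdeal D.R := rfl

/-- The embedding dimension is `2`: `𝔪` needs exactly two generators. [cite: Matsumura1987, Thm. 14.2] -/
theorem spanFinrank_maxIdeal : D.maxIdeal.spanFinrank = 2 := by
  haveI := D.isRegularLocalRing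
  have h := IsRegularLocalRing.spanFinrank_maximalIdeal (R := D.R)
  rw [D.ringKrullDim_eq_two] at h
  show (IsLocalRing.maximalIdeal D.R).spanFinrank = 2
  exact_mod_cast h

/-! ## §5. (s3) The END-FRAME at a lineage point and its `TameLowCorner` -/

/-- [OURS · L1 W4.2] **(s3) THE TAME-LOW END-FRAME** of the coefficient datum at a lineage point `y ∈ H₂` AFTER the base-point phase (`𝔞♮ = ⊤`) and the
snc phase: a regular system of parameters `(f₁, f₂)` of `R = 𝒪_{H₂,y}` — the two snc branches through `y` of `(member traces) ∪ (branches of g)`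
(a missing second branch: any complementary parameter, weight `0` = T-L5's PHANTOM ray) — their ray ids `r₁ ≠ r₂` and a dummy id `d` for the d-flat
embedding (lineage bookkeeping supplies them), and the MONOMIALITY LAW «`𝔪on · g = f₁^{w₁} · f₂^{w₂} ·` unit». Replaces the role of «`𝔞 = u^a w^b ·` unit
in snc parameters `(u, w)` of `H₂` at `y`» of SUPPLEMENT (MD′) (TL4)(iii); NOT a statement of the manuscript. [folklore] -/
structure EndFrame where
  /-- first snc branch through `y` -/
  f₁ : D.R
  /-- second snc branch through `y` (or a phantom complementary parameter) -/
  f₂ : D.R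
  /-- `(f₁, f₂)` is a regular system of parameters of `𝒪_{H₂,y}` -/
  span_pair_eq : Ideal.span {f₁, f₂} = D.maxIdeal
  /-- weight of the first branch in the principal part `𝔪on · g` -/
  w₁ : ℕ
  /-- weight of the second branch (`0` for a phantom) -/
  w₂ : ℕ
  /-- the unit of the monomial presentation -/
  unit : D.R
  /-- it is a unit -/
  isUnit_unit : IsUnit unit
  /-- MONOMIALITY after the snc phase: `𝔪on · g = f₁^{w₁} f₂^{w₂} · unit` -/
  principal_eq : D.monomial * D.principalPart = f₁ ^ w₁ * f₂ ^ w₂ * unit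
  /-- the base-point phase is over: `𝔞♮ = ⊤` -/
  residual_eq_top : D.residual = ⊤
  /-- ray id of the first branch -/
  r₁ : ℕ
  /-- ray id of the second branch -/
  r₂ : ℕ
  /-- dummy ray id of the d-flat embedding -/
  d : ℕ
  /-- distinct branch ids -/
  h₁₂ : r₁ ≠ r₂
  /-- dummy id fresh -/
  hd₁ : d ≠ r₁
  /-- dummy id fresh -/
  hd₂ : d ≠ r₂

namespace EndFrame

variable {D} (F : D.EndFrame)

/-- [OURS · L1 W4.2] **(s3) THE ROW MAP**: the end-frame's `TameLowCorner` (res-L1-s42-pv-2's T-L5 datum, p556956) — weights `w₁, w₂`, threshold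
`c = m·S₀` of the datum. The END-GAME reading (legal faces, Q-allowed moves, termination `endgame_eresolvableAvoiding`, fuel `w₁ + w₂`) is then
T-L5's, BY NAME. [folklore] -/
def toCorner : Sigma.TameLowCorner where
  r₁ := F.r₁
  r₂ := F.r₂
  d := F.d
  w₁ := F.w₁
  w₂ := F.w₂
  c := D.c
  hc := D.c_pos
  h₁₂ := F.h₁₂
  hd₁ := F.hd₁
  hd₂ := F.hd₂

/-- Unfolding. [folklore] -/
@[simp] theorem toCorner_w₁ : F.toCorner.w₁ = F.w₁ := rfl
/-- Unfolding. [folklore] -/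
@[simp] theorem toCorner_w₂ : F.toCorner.w₂ = F.w₂ := rfl
/-- Unfolding. [folklore] -/
@[simp] theorem toCorner_c : F.toCorner.c = D.c := rfl
/-- Unfolding. [folklore] -/
@[simp] theorem toCorner_r₁ : F.toCorner.r₁ = F.r₁ := rfl
/-- Unfolding. [folklore] -/
@[simp] theorem toCorner_r₂ : F.toCorner.r₂ = F.r₂ := rfl
/-- Unfolding. [folklore] -/
@[simp] theorem toCorner_d : F.toCorner.d = F.d := rfl

/-- The regular system of parameters as a `Fin 2`-family. [folklore] -/
def rsop : Fin 2 → D.R := ![F.f₁, F.f₂]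

/-- Unfolding. [folklore] -/
theorem rsop_zero : F.rsop 0 = F.f₁ := rfl
/-- Unfolding. [folklore] -/
theorem rsop_one : F.rsop 1 = F.f₂ := rfl

/-- `span (range (f₁, f₂)) = 𝔪`. [folklore] -/
theorem span_range_rsop : haveI := D.isRegularLocalRing; Ideal.span (Set.range F.rsop) = IsLocalRing.maximalIdeal D.R := by
  rw [rsop, Matrix.range_cons_cons_empty, F.span_pair_eq]
  rfl

/-- **After the base-point phase the coefficient ideal is PRINCIPAL and snc-MONOMIAL: `𝔞 = (f₁^{w₁} f₂^{w₂})`.** [folklore] -/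
theorem coeff_eq_span : D.coeff = Ideal.span {F.f₁ ^ F.w₁ * F.f₂ ^ F.w₂} := by
  rw [D.coeff_eq, F.residual_eq_top, Ideal.mul_top, Ideal.span_singleton_mul_span_singleton, F.principal_eq,
    Ideal.span_singleton_mul_right_unit F.isUnit_unit]

/-- `f₁` is a prime element (a member of a regular system of parameters). [cite: Matsumura1987, Thm. 14.3] -/
theorem prime_f₁ : Prime F.f₁ := by
  haveI := D.isRegularLocalRing
  exact Sigma.rsop_prime D.spanFinrank_maxIdeal F.rsop F.span_range_rsop 0

/-- `f₂` is a prime element. [cite: Matsumura1987, Thm. 14.3] -/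
theorem prime_f₂ : Prime F.f₂ := by
  haveI := D.isRegularLocalRing
  exact Sigma.rsop_prime D.spanFinrank_maxIdeal F.rsop F.span_range_rsop 1

/-- `f₁ ∤ f₂` (minimality of the basis of `𝔪`). [cite: Matsumura1987, Thm. 14.2] -/
theorem not_f₁_dvd_f₂ : ¬ F.f₁ ∣ F.f₂ := by
  haveI := D.isRegularLocalRing
  exact Sigma.rsop_not_dvd_of_ne D.spanFinrank_maxIdeal F.rsop F.span_range_rsop (a := 0) (i := 1) (by decide)

/-- `f₂ ∤ f₁`. [cite: Matsumura1987, Thm. 14.2] -/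
theorem not_f₂_dvd_f₁ : ¬ F.f₂ ∣ F.f₁ := by
  haveI := D.isRegularLocalRing
  exact Sigma.rsop_not_dvd_of_ne D.spanFinrank_maxIdeal F.rsop F.span_range_rsop (a := 1) (i := 0) (by decide)

/-- `f₁` is not a unit and not zero. [folklore] -/
theorem f₁_not_isUnit : ¬ IsUnit F.f₁ := F.prime_f₁.not_unit

/-- `f₁ ≠ 0`. [folklore] -/
theorem f₁_ne_zero : F.f₁ ≠ 0 := F.prime_f₁.ne_zero

/-- `f₂` is not a unit. [folklore] -/
theorem f₂_not_isUnit : ¬ IsUnit F.f₂ := F.prime_f₂.not_unit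

/-- `f₂ ≠ 0`. [folklore] -/
theorem f₂_ne_zero : F.f₂ ≠ 0 := F.prime_f₂.ne_zero

/-- Prime powers: `q^c ∣ q^w ↔ c ≤ w` for a prime `q` of a domain. [folklore] -/
theorem pow_dvd_pow_iff_of_prime {A : Type u} [CommRing A] [IsDomain A] {q : A} (hq : Prime q) {c w : ℕ} : q ^ c ∣ q ^ w ↔ c ≤ w := by
  refine ⟨fun h => ?_, fun h => pow_dvd_pow q h⟩
  by_contra hlt
  push Not at hlt
  have h1 : q ^ (w + 1) ∣ q ^ w := (pow_dvd_pow q hlt).trans h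
  rw [pow_succ] at h1
  have h2 : q ^ w * q ∣ q ^ w * 1 := by rwa [mul_one]
  exact hq.not_unit (isUnit_of_dvd_one ((mul_dvd_mul_iff_left (pow_ne_zero w hq.ne_zero)).mp h2))

/-- **DICTIONARY, CURVE `{f₁ = 0}`: it is a legal end-game centre (`𝔞 ⊆ (f₁)^c`, i.e. `ord_{V(f₁)} Coeff(J) ≥ c`) iff `c ≤ w₁`** — T-L5's
`legal_curve₁_iff` read in the ring. [folklore] -/
theorem coeff_le_span_f₁_pow_iff : D.coeff ≤ Ideal.span {F.f₁ ^ D.c} ↔ D.c ≤ F.w₁ := by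
  haveI := D.isRegularLocalRing
  haveI : IsDomain D.R := isDomain_of_isRegularLocalRing D.R
  rw [F.coeff_eq_span, Ideal.span_singleton_le_span_singleton]
  constructor
  · intro h
    have h1 : F.f₁ ^ D.c ∣ F.f₁ ^ F.w₁ :=
      F.prime_f₁.pow_dvd_of_dvd_mul_right D.c (fun hdiv => F.not_f₁_dvd_f₂ (F.prime_f₁.dvd_of_dvd_pow hdiv)) h
    exact (pow_dvd_pow_iff_of_prime F.prime_f₁).mp h1
  · intro h
    exact (pow_dvd_pow F.f₁ h).trans (dvd_mul_right _ _)

/-- **DICTIONARY, CURVE `{f₂ = 0}`**: legal iff `c ≤ w₂`. [folklore] -/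
theorem coeff_le_span_f₂_pow_iff : D.coeff ≤ Ideal.span {F.f₂ ^ D.c} ↔ D.c ≤ F.w₂ := by
  haveI := D.isRegularLocalRing
  haveI : IsDomain D.R := isDomain_of_isRegularLocalRing D.R
  rw [F.coeff_eq_span, Ideal.span_singleton_le_span_singleton]
  constructor
  · intro h
    rw [mul_comm] at h
    have h1 : F.f₂ ^ D.c ∣ F.f₂ ^ F.w₂ :=
      F.prime_f₂.pow_dvd_of_dvd_mul_right D.c (fun hdiv => F.not_f₂_dvd_f₁ (F.prime_f₂.dvd_of_dvd_pow hdiv)) h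
    exact (pow_dvd_pow_iff_of_prime F.prime_f₂).mp h1
  · intro h
    exact (pow_dvd_pow F.f₂ h).trans (dvd_mul_left _ _)

/-- **ORDER OF THE snc MONOMIAL**: `f₁^{w₁} f₂^{w₂} ∈ 𝔪^n ↔ n ≤ w₁ + w₂` — quasi-regularity of a regular system of parameters (the monomial
`X₁^{w₁} X₂^{w₂}` has coefficient `1 ∉ 𝔪`). [cite: Matsumura1987, Thm. 17.10] -/
theorem monomial_mem_maxIdeal_pow_iff {n : ℕ} : F.f₁ ^ F.w₁ * F.f₂ ^ F.w₂ ∈ D.maxIdeal ^ n ↔ n ≤ F.w₁ + F.w₂ := by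
  haveI := D.isRegularLocalRing
  constructor
  · intro h
    by_contra hlt
    push Not at hlt
    -- the monomial form of degree `w₁ + w₂`
    classical
    let e : Fin 2 →₀ ℕ := Finsupp.single 0 F.w₁ + Finsupp.single 1 F.w₂
    let P : MvPolynomial (Fin 2) D.R := MvPolynomial.monomial e 1
    have hP : P.IsHomogeneous (F.w₁ + F.w₂) := by
      have hdeg : e.degree = F.w₁ + F.w₂ := by
        simp only [e, map_add, Finsupp.degree_single]
      rw [← hdeg]
      exact MvPolynomial.isHomogeneous_monomial _ rfl
    have heval : MvPolynomial.eval F.rsop P = F.f₁ ^ F.w₁ * F.f₂ ^ F.w₂ := by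
      simp only [P, e, MvPolynomial.eval_monomial, one_mul, Finsupp.prod_add_index', pow_zero, pow_add, implies_true,
        Finsupp.prod_single_index, rsop_zero, rsop_one]
    have hmem : MvPolynomial.eval F.rsop P ∈ IsLocalRing.maximalIdeal D.R ^ (F.w₁ + F.w₂ + 1) := by
      rw [heval]
      exact Ideal.pow_le_pow_right hlt h
    have hc := coeff_mem_maximalIdeal_of_eval_mem_pow D.spanFinrank_maxIdeal F.rsop F.span_range_rsop hP hmem e
    simp only [P, MvPolynomial.coeff_monomial, if_true] at hc
    exact (IsLocalRing.maximalIdeal.isMaximal D.R).ne_top (Ideal.eq_top_of_isUnit_mem _ hc isUnit_one)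
  · intro h
    have h1 : F.f₁ ^ F.w₁ ∈ D.maxIdeal ^ F.w₁ := Ideal.pow_mem_pow (D.mem_maxIdeal_iff.mpr F.f₁_not_isUnit) _
    have h2 : F.f₂ ^ F.w₂ ∈ D.maxIdeal ^ F.w₂ := Ideal.pow_mem_pow (D.mem_maxIdeal_iff.mpr F.f₂_not_isUnit) _
    have h12 : F.f₁ ^ F.w₁ * F.f₂ ^ F.w₂ ∈ D.maxIdeal ^ (F.w₁ + F.w₂) := by
      rw [pow_add]
      exact Ideal.mul_mem_mul h1 h2
    exact Ideal.pow_le_pow_right h h12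

/-- **DICTIONARY, ORDER AT THE POINT: `Coeff(J) ⊆ 𝔪_y^n ↔ n ≤ w₁ + w₂`** (`ord_y Coeff(J) = w₁ + w₂`). [cite: Matsumura1987, Thm. 17.10] -/
theorem coeff_le_maxIdeal_pow_iff {n : ℕ} : D.coeff ≤ D.maxIdeal ^ n ↔ n ≤ F.w₁ + F.w₂ := by
  rw [F.coeff_eq_span, Ideal.span_singleton_le_iff_mem, F.monomial_mem_maxIdeal_pow_iff]

/-- **DICTIONARY, POINT: the lineage point is still in `Sing(Coeff(J), c)` (`ord_y ≥ c`, the board corner UNRESOLVED) iff `c ≤ w₁ + w₂`** —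
T-L5's `legal_point_iff` / `resolved_iff` read in the ring. [folklore] -/
theorem coeff_le_maxIdeal_pow_c_iff : D.coeff ≤ D.maxIdeal ^ D.c ↔ D.c ≤ F.w₁ + F.w₂ := F.coeff_le_maxIdeal_pow_iff

/-- **VALUE DROP at the lineage point (`ord_y Coeff(J) < c`) iff `w₁ + w₂ < c`** (T-L5 `resolved_iff`). [folklore] -/
theorem not_coeff_le_maxIdeal_pow_c_iff : ¬ D.coeff ≤ D.maxIdeal ^ D.c ↔ F.w₁ + F.w₂ < D.c := by
  rw [F.coeff_le_maxIdeal_pow_c_iff, not_le]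

/-- **The three dictionary entries against T-L5's board lemmas** (same right-hand sides): curve₁ / curve₂ legality and resolution of the corner, so the
board's verdicts ARE the ring's. [folklore] -/
theorem board_dictionary :
    (D.coeff ≤ Ideal.span {F.f₁ ^ D.c} ↔ F.toCorner.board.Legal F.toCorner.c {F.toCorner.r₁}) ∧
      (D.coeff ≤ Ideal.span {F.f₂ ^ D.c} ↔ F.toCorner.board.Legal F.toCorner.c {F.toCorner.r₂}) ∧
        (¬ D.coeff ≤ D.maxIdeal ^ D.c ↔ F.toCorner.board.Resolved F.toCorner.c (insert F.toCorner.d {F.toCorner.r₁, F.toCorner.r₂})) := by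
  refine ⟨?_, ?_, ?_⟩
  · rw [F.coeff_le_span_f₁_pow_iff, Sigma.TameLowCorner.legal_curve₁_iff]; rfl
  · rw [F.coeff_le_span_f₂_pow_iff, Sigma.TameLowCorner.legal_curve₂_iff]; rfl
  · rw [F.not_coeff_le_maxIdeal_pow_c_iff, Sigma.TameLowCorner.resolved_iff]; rfl

end EndFrame

/-! ## §6. (s4) The TAME-LOW fuel triple (values only; the drops are row T-L6) -/

/-- [OURS · L1 W4.2] **(s4) THE TAME-LOW LINEAGE FUEL** `(#base points, snc defect, weight sum) ∈ ℕ ×ₗ ℕ ×ₗ ℕ` (RULING v3.14-48 (PD)(vi)): first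
coordinate `basePointCount` (§3), second the snc DEFECT `δ` of `(V(g_red) ∪ traces)` at the lineage point (an `ℕ`-valued READING supplied by row T-L4 —
«`Σ_q (m_q − 1) + #`points with `≥ 3` branches» over the infinitely near points, F-75-bounded), third the end-game weight sum (T-L5 `TameLowCorner.fuel`,
`0` before the end-frame exists). VALUES ONLY: that each phase's step lowers the triple lexicographically is row T-L6. The codomain is well-founded
(`WellFoundedLT (ℕ ×ₗ ℕ ×ₗ ℕ)`, Mathlib), as 002's `GroupRankReadingAny` requires. NOT a statement of the manuscript. [folklore] -/
def fuel (δ : ℕ) (w : ℕ) : ℕ ×ₗ ℕ ×ₗ ℕ := toLex (D.basePointCount, toLex (δ, w))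

/-- The fuel of an end-frame: `(0, 0, w₁ + w₂)` — base points and snc defect are gone by then. [folklore] -/
def EndFrame.fuel {D : CoeffDatum K} (F : D.EndFrame) : ℕ ×ₗ ℕ ×ₗ ℕ := toLex (0, toLex (0, F.toCorner.fuel))

/-- Unfolding the first coordinate. [folklore] -/
theorem fuel_fst (δ w : ℕ) : (ofLex (D.fuel δ w)).1 = D.basePointCount := rfl

/-- **Lex comparison, first coordinate**: fewer base points ⇒ smaller fuel, whatever the rest (the shape of the base-point-phase drop law of T-L6).
[folklore] -/
theorem fuel_lt_of_basePointCount_lt {D D' : CoeffDatum K} (h : D'.basePointCount < D.basePointCount) (δ δ' w w' : ℕ) :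
    D'.fuel δ' w' < D.fuel δ w :=
  Prod.Lex.toLex_lt_toLex.mpr (Or.inl h)

/-- **Lex comparison, second coordinate** at equal base-point count. [folklore] -/
theorem fuel_lt_of_snc_lt {D D' : CoeffDatum K} (h0 : D'.basePointCount = D.basePointCount) {δ δ' : ℕ} (h : δ' < δ) (w w' : ℕ) :
    D'.fuel δ' w' < D.fuel δ w :=
  Prod.Lex.toLex_lt_toLex.mpr (Or.inr ⟨h0, Prod.Lex.toLex_lt_toLex.mpr (Or.inl h)⟩)

/-- **Lex comparison, third coordinate** at equal first two. [folklore] -/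
theorem fuel_lt_of_weight_lt {D D' : CoeffDatum K} (h0 : D'.basePointCount = D.basePointCount) (δ : ℕ) {w w' : ℕ} (h : w' < w) :
    D'.fuel δ w' < D.fuel δ w :=
  Prod.Lex.toLex_lt_toLex.mpr (Or.inr ⟨h0, Prod.Lex.toLex_lt_toLex.mpr (Or.inr ⟨rfl, h⟩)⟩)

/-- The end-frame fuel has first two coordinates `0` and third `w₁ + w₂`; an end-game step lowers it iff it lowers `w₁ + w₂` (T-L5's
`fuel_curve₁_lt` / `fuel_curve₂_lt` / `fuel_pointChild_lt`). [folklore] -/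
theorem EndFrame.fuel_lt_iff {D D' : CoeffDatum K} (F : D.EndFrame) (F' : D'.EndFrame) :
    F'.fuel < F.fuel ↔ F'.toCorner.fuel < F.toCorner.fuel := by
  rw [EndFrame.fuel, EndFrame.fuel, Prod.Lex.toLex_lt_toLex, Prod.Lex.toLex_lt_toLex]
  simp only [lt_self_iff_false, false_or, true_and]

end CoeffDatum

end Summit.ResolutionOfSingularities.ResolutionOfSingularities.Theorems.SigmaMaxModificationsCorridor3.Sigma.TameLow

end
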